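import Summits.QuantumAdvantage.QuantumAdvantage.Theorems.SymplecticPurityGraphStateSpectrum

/-!
# Crux `DlogGraphFlat` (stmt-QuantumAdvantage-10732), line `Sketch` — stub `stub_dlogWalshRange`

Sector B, `α = 0`: the range bias of the `y`-register of Shor's DLOG graph state
`Σ_x |x⟩|gˣ mod p⟩`. For a prime `p < 2ⁿ` in the window `2ⁿ ≤ p + 2^{⌊53n/100⌋}`, an element
`g` of order `p − 1` modulo `p`, and a non-zero digit mask `β : QReg n`, the digit sign
`w(y) = ∏ᵢ (−1)^{βᵢ yᵢ}` satisfies `|Σ_{x : QReg n} w(g^{ofBits x} mod p)| ≤ 2·2^{⌊53n/100⌋} + 2`.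

Proof. Reindex `x` by `m = ofBits x ∈ [0, 2ⁿ)`. For `m < p − 1` the map `m ↦ gᵐ mod p` is a
bijection onto `[1, p)` (injective because `g` has order `p − 1`; the values are non-zero
residues; equal cardinalities), so that part of the sum is
`Σ_{1 ≤ y < p} w(y) = Σ_{y < 2ⁿ} w(y) − w(0) − Σ_{p ≤ y < 2ⁿ} w(y)` with `Σ_{y<2ⁿ} w(y) = 0`
(a non-trivial character of `𝔽₂ⁿ`, `walsh_sum_eq_zero`). The tail `p − 1 ≤ m < 2ⁿ` has
`2ⁿ − p + 1` unimodular terms. Hence the modulus is at most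
`(1 + (2ⁿ − p)) + (2ⁿ − p + 1) = 2(2ⁿ − p) + 2 ≤ 2·2^{⌊53n/100⌋} + 2`.
-/

set_option linter.dupNamespace false -- D-0017: single-problem summit ⇒ `QuantumAdvantage.QuantumAdvantage` by design

namespace Summit.QuantumAdvantage.QuantumAdvantage.Theorems.SymplecticPurity

open Finset Literature.Computability.QuantumComplexity Literature.Computability.Cryptography

namespace DlogWalshRange

/-! ### Reindexing registers by integers -/

/-- Reindexing a sum over `n`-bit registers as a sum over `[0, 2ⁿ)` (the bijection
`Nat.ofBits` / `Nat.testBit`). [folklore] -/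
theorem sum_qReg_eq_sum_range {M : Type*} [AddCommMonoid M] {n : ℕ} (f : ℕ → M) :
    ∑ x : QReg n, f (Nat.ofBits x) = ∑ m ∈ range (2 ^ n), f m := by
  -- adapted from Literature.Computability.AlgebraicComplexity.BoolGadgets.sum_boolVec_eq_sum_range
  -- (BooleanGadgets.lean), which is not imported here
  refine Finset.sum_nbij' (fun x => Nat.ofBits x) (fun m => fun i : Fin n => m.testBit i)
    ?_ ?_ ?_ ?_ ?_
  · intro x _; exact Finset.mem_range.2 (Nat.ofBits_lt_two_pow x)
  · intro m _; exact Finset.mem_univ _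
  · intro x _; funext i; simp
  · intro m hm; rw [Nat.ofBits_testBit, Nat.mod_eq_of_lt (Finset.mem_range.1 hm)]
  · intro x _; rfl

/-- A sum of terms of modulus at most one is bounded by the number of terms. [folklore] -/
theorem abs_sum_le_card_of_abs_le_one {ι : Type*} (s : Finset ι) (f : ι → ℝ)
    (hf : ∀ i ∈ s, |f i| ≤ 1) : |∑ i ∈ s, f i| ≤ s.card := by
  calc |∑ i ∈ s, f i| ≤ ∑ i ∈ s, |f i| := Finset.abs_sum_le_sum_abs _ _
    _ ≤ ∑ _i ∈ s, (1 : ℝ) := Finset.sum_le_sum hf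
    _ = s.card := by simp

/-! ### The orbit of an element of order `p − 1` -/

/-- Injectivity of `m ↦ gᵐ mod p` on `[0, p − 1)` when `g` has order `p − 1` modulo the prime
`p` (`gᵃ = gᵇ` with `a, b < orderOf g` forces `a = b`). [folklore] -/
theorem pow_mod_injOn_range (p g : ℕ) (hp : p.Prime) (hg : orderOf (g : ZMod p) = p - 1) :
    Set.InjOn (fun m => g ^ m % p) (range (p - 1) : Finset ℕ) := by
  haveI := Fact.mk hp
  intro m₁ hm₁ m₂ hm₂ h
  have h' : g ^ m₁ % p = g ^ m₂ % p := h
  have e : ∀ m, ((g ^ m % p : ℕ) : ZMod p) = (g : ZMod p) ^ m := fun m => by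
    rw [ZMod.natCast_mod, Nat.cast_pow]
  have hpow : (g : ZMod p) ^ m₁ = (g : ZMod p) ^ m₂ := by
    rw [← e m₁, ← e m₂, h']
  refine pow_injOn_Iio_orderOf (x := (g : ZMod p)) ?_ ?_ hpow
  · rw [Set.mem_Iio, hg]; exact Finset.mem_range.1 hm₁
  · rw [Set.mem_Iio, hg]; exact Finset.mem_range.1 hm₂

/-- **The orbit of an element of order `p − 1` covers the non-zero residues once.** For a prime
`p` and `g` with `orderOf (g : ZMod p) = p − 1`, `m ↦ gᵐ mod p` maps `[0, p − 1)` bijectively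
onto `[1, p)` (injective by `pow_mod_injOn_range`, the values are non-zero since `g ≠ 0`, and the
two sets have `p − 1` elements). [folklore] -/
theorem image_pow_mod_range_eq_Ico (p g : ℕ) (hp : p.Prime)
    (hg : orderOf (g : ZMod p) = p - 1) :
    (range (p - 1)).image (fun m => g ^ m % p) = Ico 1 p := by
  haveI := Fact.mk hp
  have hg0 : (g : ZMod p) ≠ 0 := by
    intro hz
    have h1 : (g : ZMod p) ^ (p - 1) = 1 := by rw [← hg]; exact pow_orderOf_eq_one _
    rw [hz, zero_pow (Nat.sub_ne_zero_of_lt hp.one_lt)] at h1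
    exact zero_ne_one h1
  apply Finset.eq_of_subset_of_card_le
  · intro y hy
    obtain ⟨m, -, rfl⟩ := Finset.mem_image.1 hy
    rw [Finset.mem_Ico]
    refine ⟨Nat.one_le_iff_ne_zero.2 fun h0 => ?_, Nat.mod_lt _ hp.pos⟩
    apply pow_ne_zero m hg0
    have e : ((g ^ m % p : ℕ) : ZMod p) = (g : ZMod p) ^ m := by
      rw [ZMod.natCast_mod, Nat.cast_pow]
    rw [← e, h0, Nat.cast_zero]
  · rw [Nat.card_Ico, Finset.card_image_of_injOn (pow_mod_injOn_range p g hp hg),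
      Finset.card_range]

/-! ### The range bias -/

/-- **Range bias, abstract form.** If `|w| ≤ 1` pointwise and `Σ_{y<2ⁿ} w(y) = 0`, then for a
prime `p < 2ⁿ` and `g` of order `p − 1` modulo `p`, `|Σ_{m<2ⁿ} w(gᵐ mod p)| ≤ 2(2ⁿ − p) + 2`:
the orbit part `m < p − 1` equals `Σ_{1≤y<p} w(y) = −w(0) − Σ_{p≤y<2ⁿ} w(y)`, and the tail
`p − 1 ≤ m < 2ⁿ` has `2ⁿ − p + 1` unimodular terms. [folklore] -/
theorem abs_sum_pow_mod_le (n p g : ℕ) (hp : p.Prime) (hpn : p < 2 ^ n)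
    (hg : orderOf (g : ZMod p) = p - 1) (w : ℕ → ℝ) (hw1 : ∀ y, |w y| ≤ 1)
    (hw0 : ∑ y ∈ range (2 ^ n), w y = 0) :
    |∑ m ∈ range (2 ^ n), w (g ^ m % p)| ≤ 2 * ((2 ^ n - p : ℕ) : ℝ) + 2 := by
  have hp1 : 1 ≤ p := hp.one_lt.le
  -- split the exponent range at `p - 1`
  rw [← Finset.sum_range_add_sum_Ico _ (show p - 1 ≤ 2 ^ n by omega)]
  -- the orbit part is a permutation of `[1, p)`
  have horbit : ∑ m ∈ range (p - 1), w (g ^ m % p) = ∑ y ∈ Ico 1 p, w y := by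
    rw [← image_pow_mod_range_eq_Ico p g hp hg, Finset.sum_image (pow_mod_injOn_range p g hp hg)]
  -- split the value range at `p` and peel off `y = 0`
  have hsplit : ∑ y ∈ Ico 1 p, w y = -(w 0 + ∑ y ∈ Ico p (2 ^ n), w y) := by
    have h1 := Finset.sum_range_add_sum_Ico w hpn.le
    have h2 := Finset.sum_range_eq_add_Ico w hp.pos
    linarith
  rw [horbit, hsplit]
  have htail1 := abs_sum_le_card_of_abs_le_one (Ico p (2 ^ n)) w fun y _ => hw1 y
  have htail2 := abs_sum_le_card_of_abs_le_one (Ico (p - 1) (2 ^ n)) (fun m => w (g ^ m % p))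
    fun m _ => hw1 _
  rw [Nat.card_Ico] at htail1 htail2
  have hw00 := hw1 0
  have hcast : ((2 ^ n - (p - 1) : ℕ) : ℝ) = ((2 ^ n - p : ℕ) : ℝ) + 1 := by
    have : 2 ^ n - (p - 1) = (2 ^ n - p) + 1 := by omega
    rw [this]; push_cast; ring
  calc |-(w 0 + ∑ y ∈ Ico p (2 ^ n), w y) + ∑ m ∈ Ico (p - 1) (2 ^ n), w (g ^ m % p)|
      ≤ |-(w 0 + ∑ y ∈ Ico p (2 ^ n), w y)| + |∑ m ∈ Ico (p - 1) (2 ^ n), w (g ^ m % p)| :=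
        abs_add_le _ _
    _ ≤ (|w 0| + |∑ y ∈ Ico p (2 ^ n), w y|) + |∑ m ∈ Ico (p - 1) (2 ^ n), w (g ^ m % p)| := by
        rw [abs_neg]
        gcongr
        exact abs_add_le _ _
    _ ≤ (1 + ((2 ^ n - p : ℕ) : ℝ)) + ((2 ^ n - (p - 1) : ℕ) : ℝ) := by gcongr
    _ = 2 * ((2 ^ n - p : ℕ) : ℝ) + 2 := by rw [hcast]; ring

end DlogWalshRange

open DlogWalshRange in
/-- **Stub (sector B, `α = 0`): range bias of the `y`-register.** For a window prime `p < 2ⁿ`,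
`2ⁿ ≤ p + 2^{⌊53n/100⌋}`, and `g` of order `p − 1` modulo `p`, every non-trivial Walsh
coefficient of the multiset `{gˣ mod p : x < 2ⁿ}` is at most `2·2^{⌊53n/100⌋} + 2`: the orbit
covers `[1, p−1]` once for `x < p − 1`, the tail `p − 1 ≤ x < 2ⁿ` has `2ⁿ − p + 1` terms, and
`Σ_{y<2ⁿ} (−1)^{β·y} = 0`. [folklore] -/
theorem stub_dlogWalshRange : ∀ (n p g : ℕ), p.Prime → p < 2 ^ n → 2 ^ n ≤ p + 2 ^ (53 * n / 100) →
    orderOf (g : ZMod p) = p - 1 → ∀ β : QReg n, β ≠ (fun _ => false) →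
    |∑ x : QReg n, ∏ i : Fin n, (if β i && (g ^ Nat.ofBits x % p).testBit (i : ℕ) then (-1 : ℝ) else 1)|
      ≤ 2 * 2 ^ (53 * n / 100) + 2 := by
  intro n p g hp hpn hwin hg β hβ
  -- the digit sign `w`
  let w : ℕ → ℝ := fun y => ∏ i : Fin n, (if β i && y.testBit (i : ℕ) then (-1 : ℝ) else 1)
  have hw1 : ∀ y, |w y| ≤ 1 := by
    intro y
    show |∏ i : Fin n, (if β i && y.testBit (i : ℕ) then (-1 : ℝ) else 1)| ≤ 1
    rw [Finset.abs_prod]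
    refine Finset.prod_le_one (fun i _ => abs_nonneg _) fun i _ => ?_
    split_ifs <;> simp
  have hw0 : ∑ y ∈ range (2 ^ n), w y = 0 := by
    rw [← sum_qReg_eq_sum_range, ← walsh_sum_eq_zero β hβ]
    refine Finset.sum_congr rfl fun x _ => ?_
    refine Finset.prod_congr rfl fun i _ => ?_
    rw [Nat.testBit_ofBits_lt x i i.isLt]
  have hmain := abs_sum_pow_mod_le n p g hp hpn hg w hw1 hw0
  rw [← sum_qReg_eq_sum_range (fun m => w (g ^ m % p))] at hmain
  have h53 : 2 ^ n - p ≤ 2 ^ (53 * n / 100) := by omega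
  have h53' : ((2 ^ n - p : ℕ) : ℝ) ≤ 2 ^ (53 * n / 100) := by exact_mod_cast h53
  calc |∑ x : QReg n, ∏ i : Fin n,
          (if β i && (g ^ Nat.ofBits x % p).testBit (i : ℕ) then (-1 : ℝ) else 1)|
      = |∑ x : QReg n, w (g ^ Nat.ofBits x % p)| := rfl
    _ ≤ 2 * ((2 ^ n - p : ℕ) : ℝ) + 2 := hmain
    _ ≤ 2 * 2 ^ (53 * n / 100) + 2 := by linarith

end Summit.QuantumAdvantage.QuantumAdvantage.Theorems.SymplecticPurity
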